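import Literature.MathematicalPhysics.QuantumFieldTheory.Balaban1983to89.T3MinimiserStabilityReduction
import Literature.MathematicalPhysics.QuantumFieldTheory.Balaban1983to89.T3PrintedRegularMinimiser
import Literature.MathematicalPhysics.QuantumFieldTheory.Balaban1983to89.T3OrbitAverage
import Literature.MathematicalPhysics.QuantumFieldTheory.Balaban1983to89.B12ContinuousTransportInvariance
import Literature.MathematicalPhysics.QuantumFieldTheory.Balaban1983to89.Node00.CanonicalTransportOfRecord
import HarnessLib

/-!
# LINE g24-3 «POLYMER FORM» — S2β (and GRAD∘) by FINITE-SUM ALGEBRA from ONE print-shaped row: the fluctuation part is a localized sum with small window-oscillations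
(ideator `ym-r3-idea-1` g24, lens «control»; crux `stmt-QuantumFields-20520` = `UnitScaleTilt.FluctuationComparisonRegPrIntL`, rung R3 = continuum SU(2) YM₃ on T³)

TARGETS (concluded BY NAME, texts byte-identical, §0): the PATH-B organ **S2β** `FluctuationPartSmall` (registry `Lines/semiclassical_s2beta.lean` v11.4 §2 =
`Lines/runpair_organ.lean` = `Lines/suptail_split.lean` §1 = `Lines/gradient_split.lean` §0) and the first-order row **GRAD∘** `OneBondOscillationCan` of LINE g24-1.

THE OBSERVATION (control lens, third pass: WHAT STRUCTURE controls S2β?).  S2β is HISTORY-FREE: it speaks of `f := log ρ + β_K·𝔄^reg` for ANY continuous positive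
window version `ρ` of the FULL level-`J` law `ν_{K,J}`.  Print's OUTPUT for exactly this object on the small-field domain is a REPRESENTATION, not an estimate:
`f(U) = c₀ + Σ_X T(X,U)` — a finite sum of LOCALIZED terms (`T(X,·)` depends on `U|_X`), the small-field terms `E^{(j)}(X,U)` of [Balaban1987RG1] (0.24)–(0.25)
p.257 (analytic, gauge invariant, `|E| ≤ E₀e^{−κd_j(X)}`, constants uniform in the spacing, p.259) AND the large-field `R`-terms `R′^{(k)}(X,U)` of
[Balaban1989LargeFieldII] (1.98)–(1.100) p.390 (`|R′| ≤ e^{−p₀(g_k)}e^{−κd_k(X)}`, U|_X-dependent, analytic on the same spaces) — the large-field HISTORIES are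
already integrated into the exponent by the R-operation, so NO odds functional, NO history partition, NO interior fraction appears.  From such a representation
BOTH currencies of the g24 lines follow by FINITE-SUM ALGEBRA (PROVED in §2, abstractly, for any localized sum on any finite product space):
   one bond   `|f U − f V| ≤ Σ_{X ∋ b} osc_X`                        (terms not containing `b` cancel),
   4-point    `|(fU − fV) − (fW − fZ)| ≤ 2·Σ_{X ∋ b, b′} osc_X`        (terms missing `b` OR `b′` cancel — the connected 4-point only sees terms pinned at BOTH bonds),
where `osc_X` is the oscillation of `T(X,·)` over the window.  Hence the NEW ROW **POLY∘** `FluctuationPolymerCan`: the representation + the two SUMMED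
oscillation bounds `Σ_{X∋b} osc_X ≤ φ_J`, `Σ_{X∋b,b′} osc_X ≤ φ_J e^{−κ·tdist(b,b′)}`, `φ` super-polynomial — and ✓`fluctuationPartSmall_of_polymer : POLY∘ → S2β`,
✓`oneBondOscillation_of_polymer : POLY∘ → GRAD∘`.  Why the summed bounds are print-shaped: window-oscillation of a small-field term is `O((θ_J d(X))²)e^{−κd(X)}`
(flat is a critical point of every gauge-invariant analytic `E(X,·)` on a contractible `X` — an Ad-invariant linear functional on `su(2)^{bonds}` vanishes — and the
scaling variable is admissible up to `|z| ≍ α₁∕(θ_J d(X))` in the analyticity space (1.11)–(1.14) p.262, so the Schwarz lemma gives the square); of an `R`-term it is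
`≤ 2e^{−p₀(g_k)}e^{−κd_k(X)}` outright; lattice-animal summation over `X ∋ b, b′` with `κ` large gives `φ_J = O(θ_J²) + O(Σ_k e^{−p₀(g_k)}·L^{3(J−k)})`, super-polynomial
(indeed geometric) in `J`, times `e^{−κ′ tdist(b,b′)}`.

WHAT THIS LINE SAYS ABOUT THE CONE (honest, problem-relative).  Cones for S2β now on file: registry {EXW, GAP♯, DET-REP-B‴, H4ᶜ∘, LFR♯ᶜ∘} (second-order
semiclassics + large-field remainder); g24-1 {GRAD∘, CRUDELOC}; g24-2 {OSC¹∘, TAILSUP∘, CRUDELOC}; g24-3 {POLY∘}.  POLY∘ is ONE letter and it is STRONGER than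
S2β (anti-reduction: it asserts print's localized STRUCTURE, which S2β does not) — its justification is that it is the literal OUTPUT FORM of print's two main
constructions (RG1 Thm 1 for the small-field terms, LF-II §1 for the R-terms), read with one Schwarz corollary; it is history-free like S2β, so the R3-FLIN boundary
layer and the «pointwise conditional odds» frontier (TAILSUP∘ ∕ COND-ODDS∘ ∕ MSTEP∘ of g22) do not arise — those letters are artefacts of splitting `ρ` by the
TREE's `histGood` partition, not of S2β.  What POLY∘ COSTS: it is a mega-letter (XL+): proving it in the tree is transcribing RG1–RG2–LF-I–LF-II for the T³ scheme,
plus (a) below.  The line's use is census-level: S2β carries NO analytic content beyond print's representation theorem; every finer cone is a choice of HOW to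
transcribe, and the finite-sum algebra that turns the representation into S2β's two currencies is now PROVED once, abstractly (§2), for all of them.

WHY IT MIGHT FAIL: (a) print's final density on the small-field domain still carries an explicit (positive) sum over the most recent large-field strata with
boundary terms `B′(X)` (LF-II after (1.98)); putting `log Σ_Z` into localized form needs one more convergent Mayer step with activities `e^{−p₀(g_k)}` — standard
polymer algebra, but not a numbered theorem of print for the LAST step; (b) dictionary: the tree's `descend`∕`ℰp` scheme must be print's averaging and energy
renormalisation (the caveat every registry row carries); (c) the oscillation clause is (0.25) + the Schwarz corollary, not verbatim print; (d) toron sector of T³: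
domains wrapping the torus contribute `O(e^{−κN_J})`, geometric in `J` for fixed `F` (φ is chosen after `F`); (e) ERRATUM E1 (v3): print's terms are local in the
BACKGROUND field `U_k(V)|_X` ([Balaban1987RG1] (0.22)–(0.24); [Balaban1985UV3] p.263; typed: `AlphaDataT3.IsLocal` = fine-field locality), not in the
integration variable; POLY∘'s exact WINDOW-field locality needs the telescoping re-localization of `V ↦ U_k(V)` (exponential decay ∕ analyticity of the
minimiser in `V`, [Balaban1985Variational]) — a second standard-but-unprinted expansion, load-bearing together with (a).  Cheapest falsifier: FL-12 (POLY∘ ⇒ GRAD∘ ⇒ the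
one-bond response column); structurally, any window datum at which `log ρ` fails to be a sum of `U|_X`-local terms with summable oscillations (Gaussian tower
FL-10s: `log ρ` = local quadratic form + constant — consistent).

v3 (pen's ERRATUM E1, after reading the typed interface `T3AlphaInputsAC.AlphaDataT3`): WHY-FAIL (e) added — minimiser re-localization (background-field vs
window-field locality); rows and proofs byte-identical to v2.
v2 (critic #476): clause (ii) of POLY∘ weakened to ONE-BOND pairs (the only pairs the pin algebra ever feeds it — P2), size label «XL+ = transcription + one
cluster-expansion logarithm» (P1); junction proofs unchanged but for threading the bond.

Sorries = {POLY∘ `stub_fluctuationPolymerCan` (NEW, XL+)}; 0 elsewhere.  PUBLISHED organ-level line (RULING №36 (3)): NOT registered as the crux item's skeleton.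
No summit is proved by a line; `YM3TorusSU2` is NOT proved (S1a, 26243, S2α′, O1 stay open; S2β is proved here only modulo the row); `FluctuationComparisonRegPrIntL`
(20520) is NOT concluded by name by this file; nothing of Bałaban's asserted; rung R3 (YM₃ on T³) — NOT d = 4, NOT infinite volume, NOT a mass gap, NOT Clay.
-/

noncomputable section

open MeasureTheory Filter Topology Set
open Literature.MathematicalPhysics.QuantumFieldTheory.Balaban1983to89
open Literature.MathematicalPhysics.QuantumFieldTheory.Balaban1983to89.T3ContinuumYM3Torus
open Literature.MathematicalPhysics.QuantumFieldTheory.Balaban1983to89.T3NestedUnitLaws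
open Literature.MathematicalPhysics.QuantumFieldTheory.Balaban1983to89.T3UnitLawDensityEML
open Literature.MathematicalPhysics.QuantumFieldTheory.Balaban1983to89.T3UnitScaleTilt
open Literature.MathematicalPhysics.QuantumFieldTheory.Balaban1983to89.T3TiltDescent
open Literature.MathematicalPhysics.QuantumFieldTheory.Balaban1983to89.T3PrintedRegularMinimiser
open Literature.MathematicalPhysics.QuantumFieldTheory.Balaban1983to89.T3ConstrainedMinimiser (fibre)
open Literature.MathematicalPhysics.QuantumFieldTheory.Balaban1983to89.T3LevelShift
open Literature.MathematicalPhysics.QuantumFieldTheory.Balaban1983to89.Missing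
open Literature.MathematicalPhysics.QuantumFieldTheory.Balaban1983to89.T4Continuum

namespace Summit.QuantumFields.YangMills.Cruxes.FluctuationComparisonRegPrIntL.RunPairOrgan.PolymerForm

/-! ## §0 The TARGETS S2β and GRAD∘ (verbatim, byte-identical) -/

section Rows

/-- **S2β · FLUCTUATION PART SMALL IN 4-POINT CURRENCY** — VERBATIM from the registry `Lines/semiclassical_s2beta.lean` v11.4 §2 (= `Lines/runpair_organ.lean`,
`Lines/suptail_split.lean` §1, `Lines/gradient_split.lean` §0; version-free: it quantifies over continuous positive versions `ρ`). [cite: Balaban1985UV3, Thm 2 p.263 and (41) p.266] -/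
def FluctuationPartSmall : Prop :=
  ∀ (L : ℕ), ∃ pS : ℝ, ∀ (b₀ p₀ : ℝ), 0 < b₀ → pS ≤ p₀ → 0 < p₀ → ∃ ε₁ : ℝ, 0 < ε₁ ∧ ∀ (ε₀ : ℝ), 0 < ε₀ → ε₀ ≤ ε₁ →
    ∃ γ₁ : ℝ, 0 < γ₁ ∧ ∃ κ : ℝ, 0 < κ ∧ ∀ (F : T3Family) (γ : ℝ), F.L = L → 0 < γ → γ ≤ γ₁ →
      ∃ (φ : ℕ → ℝ), (∀ J, 0 ≤ φ J) ∧ Tendsto (fun J : ℕ => (J : ℝ) * φ J) atTop (𝓝 0) ∧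
        ∀ (ν : ℕ → (j : ℕ) → Measure (GaugeField (F.P j) 0 (Matrix.specialUnitaryGroup (Fin 2) ℂ))),
          (∀ K, ν K K = T4GenFunBounds.gibbsMeasure (F.P K) ((F.scheme ℰp γ).β K)) →
          (∀ K j, j < K → ν K j = Measure.map (descend F ℰp j) (ν K (j + 1))) →
          ∀ (J K : ℕ) (hJK : J ≤ K) (ρ : GaugeField (F.P J) 0 (Matrix.specialUnitaryGroup (Fin 2) ℂ) → ℝ),
            (∀ U, PlaqSmall (θBal F.L γ b₀ p₀ J) U → 0 < ρ U) →
            ν K J = (fieldMeasure _ _ _).withDensity (fun U => ENNReal.ofReal (ρ U)) →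
            ContinuousOn ρ {U | PlaqSmall (θBal F.L γ b₀ p₀ J) U} →
            ∀ (b b' : PBond (F.P J) 0) (U V W Z : GaugeField (F.P J) 0 (Matrix.specialUnitaryGroup (Fin 2) ℂ)),
              PlaqSmall (θBal F.L γ b₀ p₀ J) U → PlaqSmall (θBal F.L γ b₀ p₀ J) V →
              PlaqSmall (θBal F.L γ b₀ p₀ J) W → PlaqSmall (θBal F.L γ b₀ p₀ J) Z →
              (∀ e, e ≠ b → U e = V e) → (∀ e, e ≠ b' → U e = W e) → (∀ e, e ≠ b' → V e = Z e) → (∀ e, e ≠ b → W e = Z e) →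
              |((Real.log (ρ U) + (F.scheme ℰp γ).β K * minActionRegPr F J K hJK ε₀ U)
                  - (Real.log (ρ V) + (F.scheme ℰp γ).β K * minActionRegPr F J K hJK ε₀ V))
                - ((Real.log (ρ W) + (F.scheme ℰp γ).β K * minActionRegPr F J K hJK ε₀ W)
                  - (Real.log (ρ Z) + (F.scheme ℰp γ).β K * minActionRegPr F J K hJK ε₀ Z))|
                ≤ φ J * Real.exp (-(κ * (b.src.tdist b'.src : ℝ)))

/-- **GRAD∘ · ONE-BOND OSCILLATION OF THE FULL FLUCTUATION PART — ALL DEPTHS** — VERBATIM from LINE g24-1 `Lines/gradient_split.lean` §0 (there ★ knit with CRUDELOC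
into S2β; LINE g24-2 resolves it through GRAD¹∘ + TAILSUP∘).  Here it is a second CONSEQUENCE of POLY∘ (one-pin clause).
[cite: Balaban1987RG1, Thm 1 (0.24)-(0.25) p.257; Balaban1989LargeFieldII, (1.98)-(1.100) p.390] -/
def OneBondOscillationCan : Prop :=
  ∀ (L : ℕ), ∃ pS : ℝ, ∀ (b₀ p₀ : ℝ), 0 < b₀ → pS ≤ p₀ → 0 < p₀ → ∃ ε₁ : ℝ, 0 < ε₁ ∧ ∀ (ε₀ : ℝ), 0 < ε₀ → ε₀ ≤ ε₁ →
    ∃ γ₁ : ℝ, 0 < γ₁ ∧ ∀ (F : T3Family) (γ : ℝ), F.L = L → 0 < γ → γ ≤ γ₁ →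
      ∃ (σ : ℕ → ℝ), (∀ J, 0 ≤ σ J) ∧ (∀ a : ℕ, Tendsto (fun J : ℕ => ((J : ℝ) + 1) ^ a * σ J) atTop (𝓝 0)) ∧
        ∀ (ν : ℕ → (j : ℕ) → Measure (GaugeField (F.P j) 0 (Matrix.specialUnitaryGroup (Fin 2) ℂ))),
          (∀ K, ν K K = T4GenFunBounds.gibbsMeasure (F.P K) ((F.scheme ℰp γ).β K)) →
          (∀ K j, j < K → ν K j = Measure.map (descend F ℰp j) (ν K (j + 1))) →
          ∀ (J K : ℕ) (hJK : J ≤ K) (ρ : GaugeField (F.P J) 0 (Matrix.specialUnitaryGroup (Fin 2) ℂ) → ℝ),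
            (∀ U, PlaqSmall (θBal F.L γ b₀ p₀ J) U → 0 < ρ U) →
            ν K J = (fieldMeasure _ _ _).withDensity (fun U => ENNReal.ofReal (ρ U)) →
            ContinuousOn ρ {U | PlaqSmall (θBal F.L γ b₀ p₀ J) U} →
            ∀ (b : PBond (F.P J) 0) (U V : GaugeField (F.P J) 0 (Matrix.specialUnitaryGroup (Fin 2) ℂ)),
              PlaqSmall (θBal F.L γ b₀ p₀ J) U → PlaqSmall (θBal F.L γ b₀ p₀ J) V →
              (∀ e, e ≠ b → U e = V e) →
              |(Real.log (ρ U) + (F.scheme ℰp γ).β K * minActionRegPr F J K hJK ε₀ U)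
                  - (Real.log (ρ V) + (F.scheme ℰp γ).β K * minActionRegPr F J K hJK ε₀ V)| ≤ σ J

/-! ## §1 THE ROW: POLY∘ (NEW) — the fluctuation part of the full window density is a localized sum with summable small window-oscillations -/

/-- **POLY∘ · POLYMER FORM OF THE FLUCTUATION PART** (`FluctuationPolymerCan`, NEW; print-shaped; size XL+ = transcription of print's output form + ONE
cluster-expansion logarithm for the most recent large-field strata — critic #476-P1).  Same quantifier frame as S2β (incl. `∃ κ` before
`∀ F γ`, `φ` after); for every run `K ≥ J` and every continuous positive window version `ρ` of `ν_{K,J}` there are a constant `c₀`, LOCAL TERMS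
`T X : field → ℝ` indexed by finite bond sets `X` with `T X U` depending on `U|_X` only, and ONE-BOND OSCILLATION WEIGHTS `w X ≥ |T X U − T X V|` for window data `U, V`
agreeing off one bond (any bond; v2 — critic #476-P2: the weakest clause both junctions use, = print's per-direction Schwarz bound),
such that on the window `log ρ U + β_K·𝔄^reg U = c₀ + Σ_X T X U`, and the weights are summable with ONE pin (`Σ_{X∋b} w X ≤ φ_J`) and with TWO pins
(`Σ_{X∋b,b′} w X ≤ φ_J·e^{−κ·tdist(b,b′)}`), `φ` super-polynomially small in `J`, uniformly in `K`.  READING: `T X` = the sum of print's small-field terms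
`E^{(j)}(X′,·)` ([Balaban1987RG1] (0.24)–(0.25) p.257, Thm 1 p.259: analytic, gauge invariant, `U|_{X′}`-dependent, `|E| ≤ E₀e^{−κd_j(X′)}`, constants uniform
in the spacing; d = 3: no β-function, `g_k` by scaling, p.259 L31–33) and R-terms `R′^{(k)}(X′,·)` ([Balaban1989LargeFieldII] (1.98)–(1.100) p.390:
`|R′| ≤ e^{−p₀(g_k)}e^{−κd_k(X′)}`) over the localization domains `X′` whose bond set is `X`; `w X` = their one-bond window oscillation: `O(θ_J d)·θ_J·e^{−κd}` for
`E`-terms (flat is a critical point of a gauge-invariant analytic local term on a contractible domain; scaling variable admissible up to `α₁∕(θ_J d)` in the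
space (1.11)–(1.14) p.262; Schwarz), `2·sup` for `R`-terms; the pinned sums are lattice-animal sums with `κ` large.
WHY IT MIGHT FAIL: (a) FIRST AND LOAD-BEARING NON-PRINT STEP: the most recent large-field strata of print's final density are an explicit positive sum with
boundary terms `B′(X)`, whose logarithm needs one more convergent Mayer∕polymer-gas step to become localized — the activity-vs-entropy condition (activities
`e^{−p₀(g_k)}` against stratum entropy `e^{O(1)·#cubes}`) is the thing that can fail; standard, but not a numbered theorem of print; (b) dictionary (`descend`,
`ℰp` = print's averaging and energy renormalisation); (c) oscillation clause = (0.25) + Schwarz corollary; (d) toron sector: wrapping domains `O(e^{−κN_J})`;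
(e) SECOND NON-PRINT STEP (ERRATUM E1, v3): print's localized terms are functions of the BACKGROUND field `U_k(V)` restricted to `X` ([Balaban1987RG1]
(0.22)–(0.24) pp.256–257 «E^{(j)}(X, U) … depending on U restricted to X», `U = U_k(V)`; [Balaban1985UV3] p.263 «depends on U₁ restricted to X̃»; the
tree's typed schema `T3AlphaInputsAC.AlphaDataT3.IsLocal` is locality in the FINE field), NOT of the integration variable `V` (here: the window field
`U : GaugeField (F.P J) 0`); clause (i) below asks EXACT locality in the window field, which needs one more standard-but-unprinted expansion: the
telescoping re-localization of `V ↦ U_k(V)|_X` through the exponential decay ∕ analyticity of the minimiser's dependence on `V` ([Balaban1985Variational]).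
STRONGER than S2β and than GRAD∘ (it asserts localized structure); does NOT imply 20520 or `YM3TorusSU2` (BC2∕BC7 on the card).
[cite: Balaban1987RG1, (0.24)-(0.25) p.257, Thm 1 p.259, (1.11)-(1.14) p.262; Balaban1989LargeFieldII, (1.98)-(1.100) p.390; Balaban1985UV3, Thm 2 p.263 and (41) p.266] -/
def FluctuationPolymerCan : Prop :=
  ∀ (L : ℕ), ∃ pS : ℝ, ∀ (b₀ p₀ : ℝ), 0 < b₀ → pS ≤ p₀ → 0 < p₀ → ∃ ε₁ : ℝ, 0 < ε₁ ∧ ∀ (ε₀ : ℝ), 0 < ε₀ → ε₀ ≤ ε₁ →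
    ∃ γ₁ : ℝ, 0 < γ₁ ∧ ∃ κ : ℝ, 0 < κ ∧ ∀ (F : T3Family) (γ : ℝ), F.L = L → 0 < γ → γ ≤ γ₁ →
      ∃ (φ : ℕ → ℝ), (∀ J, 0 ≤ φ J) ∧ (∀ a : ℕ, Tendsto (fun J : ℕ => ((J : ℝ) + 1) ^ a * φ J) atTop (𝓝 0)) ∧
        ∀ (ν : ℕ → (j : ℕ) → Measure (GaugeField (F.P j) 0 (Matrix.specialUnitaryGroup (Fin 2) ℂ))),
          (∀ K, ν K K = T4GenFunBounds.gibbsMeasure (F.P K) ((F.scheme ℰp γ).β K)) →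
          (∀ K j, j < K → ν K j = Measure.map (descend F ℰp j) (ν K (j + 1))) →
          ∀ (J K : ℕ) (hJK : J ≤ K) (ρ : GaugeField (F.P J) 0 (Matrix.specialUnitaryGroup (Fin 2) ℂ) → ℝ),
            (∀ U, PlaqSmall (θBal F.L γ b₀ p₀ J) U → 0 < ρ U) →
            ν K J = (fieldMeasure _ _ _).withDensity (fun U => ENNReal.ofReal (ρ U)) →
            ContinuousOn ρ {U | PlaqSmall (θBal F.L γ b₀ p₀ J) U} →
            ∃ (c₀ : ℝ) (T : Finset (PBond (F.P J) 0) → GaugeField (F.P J) 0 (Matrix.specialUnitaryGroup (Fin 2) ℂ) → ℝ)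
              (w : Finset (PBond (F.P J) 0) → ℝ),
              (∀ (X : Finset (PBond (F.P J) 0)) (U V : GaugeField (F.P J) 0 (Matrix.specialUnitaryGroup (Fin 2) ℂ)),
                  (∀ e ∈ X, U e = V e) → T X U = T X V) ∧
              (∀ (X : Finset (PBond (F.P J) 0)) (b : PBond (F.P J) 0) (U V : GaugeField (F.P J) 0 (Matrix.specialUnitaryGroup (Fin 2) ℂ)),
                  PlaqSmall (θBal F.L γ b₀ p₀ J) U → PlaqSmall (θBal F.L γ b₀ p₀ J) V → (∀ e, e ≠ b → U e = V e) → |T X U - T X V| ≤ w X) ∧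
              (∀ b : PBond (F.P J) 0, ∑ X ∈ Finset.univ.filter (fun X => b ∈ X), w X ≤ φ J) ∧
              (∀ b b' : PBond (F.P J) 0,
                  ∑ X ∈ Finset.univ.filter (fun X => b ∈ X ∧ b' ∈ X), w X ≤ φ J * Real.exp (-(κ * (b.src.tdist b'.src : ℝ)))) ∧
              (∀ U : GaugeField (F.P J) 0 (Matrix.specialUnitaryGroup (Fin 2) ℂ), PlaqSmall (θBal F.L γ b₀ p₀ J) U →
                  Real.log (ρ U) + (F.scheme ℰp γ).β K * minActionRegPr F J K hJK ε₀ U = c₀ + ∑ X, T X U)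

end Rows

/-! ## §2 PROVED: the finite-sum algebra of localized sums (abstract: any finite index of «bonds», any value type, any window set) -/

section Algebra

/-- One pin: terms whose support misses the moved bond cancel. -/
theorem onePoint_le_pinnedSum {ι G : Type*} [Fintype ι] [DecidableEq ι] (T : Finset ι → (ι → G) → ℝ) (w : Finset ι → ℝ) (S : Set (ι → G)) (c₀ : ℝ)
    (f : (ι → G) → ℝ)
    (hloc : ∀ X U V, (∀ e ∈ X, U e = V e) → T X U = T X V)
    (hosc : ∀ X (b : ι) U V, U ∈ S → V ∈ S → (∀ e, e ≠ b → U e = V e) → |T X U - T X V| ≤ w X)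
    (hrep : ∀ U, U ∈ S → f U = c₀ + ∑ X, T X U)
    (b : ι) (U V : ι → G) (hU : U ∈ S) (hV : V ∈ S) (hUV : ∀ e, e ≠ b → U e = V e) :
    |f U - f V| ≤ ∑ X ∈ Finset.univ.filter (fun X => b ∈ X), w X := by
  have hdiff : f U - f V = ∑ X, (T X U - T X V) := by
    rw [hrep U hU, hrep V hV, Finset.sum_sub_distrib]; ring
  have hsplit := Finset.sum_filter_add_sum_filter_not Finset.univ (fun X => b ∈ X) (fun X => T X U - T X V)
  have hzero : ∑ X ∈ Finset.univ.filter (fun X => ¬ b ∈ X), (T X U - T X V) = 0 := by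
    refine Finset.sum_eq_zero ?_
    intro X hX
    have hb : b ∉ X := (Finset.mem_filter.mp hX).2
    have : T X U = T X V := hloc X U V (fun e he => hUV e (by rintro rfl; exact hb he))
    rw [this, sub_self]
  rw [hdiff, ← hsplit, hzero, add_zero]
  refine (Finset.abs_sum_le_sum_abs _ _).trans ?_
  exact Finset.sum_le_sum (fun X _ => hosc X b U V hU hV hUV)

/-- Two pins: terms whose support misses EITHER moved bond cancel in the connected 4-point. -/
theorem fourPoint_le_pinnedSum {ι G : Type*} [Fintype ι] [DecidableEq ι] (T : Finset ι → (ι → G) → ℝ) (w : Finset ι → ℝ) (S : Set (ι → G)) (c₀ : ℝ)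
    (f : (ι → G) → ℝ)
    (hloc : ∀ X U V, (∀ e ∈ X, U e = V e) → T X U = T X V)
    (hosc : ∀ X (b : ι) U V, U ∈ S → V ∈ S → (∀ e, e ≠ b → U e = V e) → |T X U - T X V| ≤ w X)
    (hrep : ∀ U, U ∈ S → f U = c₀ + ∑ X, T X U)
    (b b' : ι) (U V W Z : ι → G) (hU : U ∈ S) (hV : V ∈ S) (hW : W ∈ S) (hZ : Z ∈ S)
    (hUV : ∀ e, e ≠ b → U e = V e) (hUW : ∀ e, e ≠ b' → U e = W e) (hVZ : ∀ e, e ≠ b' → V e = Z e) (hWZ : ∀ e, e ≠ b → W e = Z e) :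
    |(f U - f V) - (f W - f Z)| ≤ ∑ X ∈ Finset.univ.filter (fun X => b ∈ X ∧ b' ∈ X), 2 * w X := by
  have hdiff : (f U - f V) - (f W - f Z) = ∑ X, ((T X U - T X V) - (T X W - T X Z)) := by
    rw [hrep U hU, hrep V hV, hrep W hW, hrep Z hZ]
    simp only [Finset.sum_sub_distrib]; ring
  have hsplit := Finset.sum_filter_add_sum_filter_not Finset.univ (fun X => b ∈ X ∧ b' ∈ X)
    (fun X => (T X U - T X V) - (T X W - T X Z))
  have hzero : ∑ X ∈ Finset.univ.filter (fun X => ¬ (b ∈ X ∧ b' ∈ X)), ((T X U - T X V) - (T X W - T X Z)) = 0 := by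
    refine Finset.sum_eq_zero ?_
    intro X hX
    have hbb : ¬ (b ∈ X ∧ b' ∈ X) := (Finset.mem_filter.mp hX).2
    by_cases hb : b ∈ X
    · have hb' : b' ∉ X := fun h => hbb ⟨hb, h⟩
      have h1 : T X U = T X W := hloc X U W (fun e he => hUW e (by rintro rfl; exact hb' he))
      have h2 : T X V = T X Z := hloc X V Z (fun e he => hVZ e (by rintro rfl; exact hb' he))
      rw [h1, h2]; ring
    · have h1 : T X U = T X V := hloc X U V (fun e he => hUV e (by rintro rfl; exact hb he))
      have h2 : T X W = T X Z := hloc X W Z (fun e he => hWZ e (by rintro rfl; exact hb he))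
      rw [h1, h2]; ring
  rw [hdiff, ← hsplit, hzero, add_zero]
  refine (Finset.abs_sum_le_sum_abs _ _).trans ?_
  refine Finset.sum_le_sum (fun X _ => ?_)
  calc |(T X U - T X V) - (T X W - T X Z)| ≤ |T X U - T X V| + |T X W - T X Z| := abs_sub _ _
    _ ≤ w X + w X := add_le_add (hosc X b U V hU hV hUV) (hosc X b W Z hW hZ hWZ)
    _ = 2 * w X := by ring

/-- Super-polynomial ⇒ S2β's modulus for the doubled weight: `J·(2φ_J) → 0`. -/
theorem tendsto_mul_two_of_superpoly {φ : ℕ → ℝ} (hφ0 : ∀ J, 0 ≤ φ J)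
    (hφ : ∀ a : ℕ, Tendsto (fun J : ℕ => ((J : ℝ) + 1) ^ a * φ J) atTop (𝓝 0)) :
    Tendsto (fun J : ℕ => (J : ℝ) * (2 * φ J)) atTop (𝓝 0) := by
  have h1 : Tendsto (fun J : ℕ => 2 * (((J : ℝ) + 1) ^ 1 * φ J)) atTop (𝓝 0) := by
    simpa using (hφ 1).const_mul 2
  refine tendsto_of_tendsto_of_tendsto_of_le_of_le tendsto_const_nhds h1 (fun J => ?_) (fun J => ?_)
  · exact mul_nonneg (Nat.cast_nonneg J) (mul_nonneg (by norm_num) (hφ0 J))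
  · have := hφ0 J
    have hJ : (0 : ℝ) ≤ J := Nat.cast_nonneg J
    nlinarith

end Algebra

/-! ## §3 PROVED: POLY∘ → S2β and POLY∘ → GRAD∘ -/

section Junctions

/-- The suffices-statements of the line. -/
def PolymerSuffices : Prop := FluctuationPolymerCan → FluctuationPartSmall

/-- ★ POLY∘ → S2β: pass the frame through, `φ_{S2β} := 2φ`, and apply the two-pin algebra to the representation. -/
theorem fluctuationPartSmall_of_polymer : PolymerSuffices := by
  intro hP L
  obtain ⟨pS, HpS⟩ := hP L
  refine ⟨pS, ?_⟩
  intro b₀ p₀ hb₀ hpS hp₀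
  obtain ⟨ε₁, hε₁, Hε⟩ := HpS b₀ p₀ hb₀ hpS hp₀
  refine ⟨ε₁, hε₁, ?_⟩
  intro ε₀ hε₀ hε₀₁
  obtain ⟨γ₁, hγ₁, κ, hκ, HF⟩ := Hε ε₀ hε₀ hε₀₁
  refine ⟨γ₁, hγ₁, κ, hκ, ?_⟩
  intro F γ hFL hγ hγ₁'
  obtain ⟨φ, hφ0, hφ, Hν⟩ := HF F γ hFL hγ hγ₁'
  refine ⟨fun J => 2 * φ J, fun J => mul_nonneg (by norm_num) (hφ0 J), tendsto_mul_two_of_superpoly hφ0 hφ, ?_⟩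
  intro ν hνK hνd J K hJK ρ hρpos hρν hρcont b b' U V W Z hU hV hW hZ hUV hUW hVZ hWZ
  obtain ⟨c₀, T, w, hloc, hosc, _h1, h2, hrep⟩ := Hν ν hνK hνd J K hJK ρ hρpos hρν hρcont
  have key := fourPoint_le_pinnedSum T w {U | PlaqSmall (θBal F.L γ b₀ p₀ J) U} c₀
    (fun U => Real.log (ρ U) + (F.scheme ℰp γ).β K * minActionRegPr F J K hJK ε₀ U)
    hloc (fun X b U V hU hV hUV => hosc X b U V hU hV hUV) (fun U hU => hrep U hU) b b' U V W Z hU hV hW hZ hUV hUW hVZ hWZ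
  refine key.trans ?_
  rw [← Finset.mul_sum]
  calc 2 * ∑ X ∈ Finset.univ.filter (fun X => b ∈ X ∧ b' ∈ X), w X
      ≤ 2 * (φ J * Real.exp (-(κ * (b.src.tdist b'.src : ℝ)))) := by
        exact mul_le_mul_of_nonneg_left (h2 b b') (by norm_num)
    _ = 2 * φ J * Real.exp (-(κ * (b.src.tdist b'.src : ℝ))) := by ring

/-- ★ POLY∘ → GRAD∘: drop `κ`, `σ := φ`, one-pin algebra. -/
theorem oneBondOscillation_of_polymer (hP : FluctuationPolymerCan) : OneBondOscillationCan := by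
  intro L
  obtain ⟨pS, HpS⟩ := hP L
  refine ⟨pS, ?_⟩
  intro b₀ p₀ hb₀ hpS hp₀
  obtain ⟨ε₁, hε₁, Hε⟩ := HpS b₀ p₀ hb₀ hpS hp₀
  refine ⟨ε₁, hε₁, ?_⟩
  intro ε₀ hε₀ hε₀₁
  obtain ⟨γ₁, hγ₁, κ, _hκ, HF⟩ := Hε ε₀ hε₀ hε₀₁
  refine ⟨γ₁, hγ₁, ?_⟩
  intro F γ hFL hγ hγ₁'
  obtain ⟨φ, hφ0, hφ, Hν⟩ := HF F γ hFL hγ hγ₁'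
  refine ⟨φ, hφ0, hφ, ?_⟩
  intro ν hνK hνd J K hJK ρ hρpos hρν hρcont b U V hU hV hUV
  obtain ⟨c₀, T, w, hloc, hosc, h1, _h2, hrep⟩ := Hν ν hνK hνd J K hJK ρ hρpos hρν hρcont
  have key := onePoint_le_pinnedSum T w {U | PlaqSmall (θBal F.L γ b₀ p₀ J) U} c₀
    (fun U => Real.log (ρ U) + (F.scheme ℰp γ).β K * minActionRegPr F J K hJK ε₀ U)
    hloc (fun X b U V hU hV hUV => hosc X b U V hU hV hUV) (fun U hU => hrep U hU) b U V hU hV hUV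
  exact key.trans (h1 b)

end Junctions

/-! ## §4 The single stub (CONTROL; the line is published, not registered) -/

section Stubs

/-- STUB POLY∘ (NEW, XL+: print's representation theorem for the T³ scheme + the last Mayer step + the Schwarz corollary). -/
theorem stub_fluctuationPolymerCan : FluctuationPolymerCan := by
  sorry

/-- CONTROL: S2β from the stub (carries `sorryAx` through the stub only). -/
theorem fluctuationPartSmall_of_stub : FluctuationPartSmall := fluctuationPartSmall_of_polymer stub_fluctuationPolymerCan

/-- CONTROL: GRAD∘ from the stub. -/
theorem oneBondOscillation_of_stub : OneBondOscillationCan := oneBondOscillation_of_polymer stub_fluctuationPolymerCan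

end Stubs

end Summit.QuantumFields.YangMills.Cruxes.FluctuationComparisonRegPrIntL.RunPairOrgan.PolymerForm
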